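import Summits.BirchSwinnertonDyer.BirchSwinnertonDyer.Theorems.SignedLowerHalvesSmallImageMuZeroOneSignFinePivotOneSign
import Literature.NumberTheory.EllipticCurves.Rank1Residual.FineMordellWeilCertificates
import Literature.NumberTheory.EllipticCurves.KatoFineSelmerDualTorsion
import Literature.NumberTheory.EllipticCurves.FineSelmerCongruentCurves
import Summits.BirchSwinnertonDyer.BirchSwinnertonDyer.Theorems.SignedLowerHalvesKobayashiMainConjectureSmallImageMuTransferUnitPartner
import Summits.BirchSwinnertonDyer.Rank1Residual.X1.MuPart
import Literature.NumberTheory.EllipticCurves.MatarNekovar2019.ShaVanishing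
import Literature.NumberTheory.EllipticCurves.Rank1Residual.Typed.SelmerCardCertificateRankZero
import HarnessLib

/-!
# Crux M `SignedLowerHalves.SmallImageMuZeroOneSign` (item stmt-BirchSwinnertonDyer-23600) — line «rs_road»:
# the RAY–SUJATHA / WUTHRICH leading-term certificate, transplanted from the ORDINARY small-image class X9 (where the
# tree cell `bsd-f3-mu` uses it: `Rank1Residual.FineMordellWeilCertificates`) to the SUPERSINGULAR small-image class of
# crux M, and composed with the fine pivot (LEAD `birth_mu` v3, `SmallImageFinePivot.oneSignMuZero_of_conjAAt`) and the
# in-tree residual invariance of Coates–Sujatha (A) (Lim–Sujatha 2018 Prop. 3.2, PROVED: `prop32_…_holds`).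

Ideator seat `bsd-idea-5` g13 (lens «transfer»; publish-only line, W-79: NOT registered as a skeleton; the line of record
is the LEAD's `birth_mu` v3).  HONEST FRAMING: every theorem below is CONDITIONAL on its displayed binders — the print
facts `RaySujatha2023.cor27_…` (hRS), `Kato2004_fineSelmerDual_isTorsion` (hKato), the three binders of the fine pivot
(`hKP hKo hMa`), for the by-name corollary the five `birth_mu` binders at `p = 3`, and the OPEN class-wide supply
statement `RsPartnerSupplyNsGeFive` (a `def`, displayed as the binder `hS`, asserted for NO class).  NO `sorry`.
Crux M, crux 4 of K3 and BSD are NOT proved by this file; BSD is not proved by any of this.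

WHAT IS NEW RELATIVE TO THE CRUX DIRECTORY (Lines/birth_mu*, Lines/fine_pivot*, Ideas/fine-pivot-minsign, PICKED.md):
those reach Conjecture A at a small-image supersingular pair ONLY through class numbers of (subfields of) the division
field `ℚ(E[p])` (Coates–Sujatha Thm 3.4 / Iwasawa 1956 / Fukuda / the `N_ns(5)` seven-leaf door) — degree `p² − 1`
arithmetic, infeasible at `p = 7` (degree 48) and `p = 11` (degree 120).  The road below reaches (A) — hence crux M's
body at the pair (`oneSignMuZero_of_raySujathaCert`) — from MORDELL–WEIL data of the curve or of ANY mod-`p` CONGRUENT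
curve (`oneSignMuZero_of_congruent_raySujathaCert`): rank ≤ 1, `p ∤ c_ℓ`, `Ш[p] = 0`, generator not `p`-divisible in
`Ê(ℚ_p)`.  No class group, no `L`-function, no `p`-adic `L`, GRH-free; uniform in `p ≥ 5`.

REV 2 (g15, §5 — the UNIT-ZONE SHORTCUT, a rider, not a new line): on the 12 rank-0 «R1 rows» of `Lines/rs_road.md` §4
(`p ∤ ∏c_ℓ · #Ш_an`, `p ∈ {5, 11}`) the SAME per-pair certificate (`Ш(E/ℚ)[p] = 0` by Matar–Nekovář + rank 0 + no rational
`p`-torsion, i.e. `#Sel^(p)(E/ℚ) = 1`, and `p ∤ ∏c_ℓ`) feeds the tree's unit-zone theorem `…Theorems.signedMu_eq_zero_of_selmerTrivial`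
(B. D. Kim 2013 Cor. 3.15: `ξ^±(0) ∼ #Sel_{p^∞}·∏c_ℓ` is a unit) INSTEAD of Ray–Sujatha Cor. 2.7 + the fine pivot: crux M's body at the
pair with TWO print binders (`h12`, `hKim`) instead of five, and for BOTH signs (`oneSignMuZero_of_matarNekovar_unitZone`); the
unit-PARTNER form (B. D. Kim 2009 Cor. 2.13, tree `…mu_eq_zero_of_unitPartner`) is the R2 analogue (`oneSignMuZero_of_unitPartner`).
Nothing new is claimed for the unit zone itself (cell bsd-ssimc, `…SmallImageMuTransferUnitPartner.lean`, 2 unit-zone records incl.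
`431433g1 @ 5` GRH-graded by explicit 5-descent): the rider only swaps the DESCENT certificate for the GRH-free Heegner-index one
(MN19), which is what makes the `p = 11` rows (232544f1, 465088bc1, 465088be1) reachable at all.

THE FIRST NON-TRANSFERRING STEP (the crux of the transfer, recorded in `Lines/rs_road.md` §3): on the `N(C_ns(p))`
class `ρ̄(I_ℓ)` has no element of order `p`, so at a multiplicative prime `ℓ` one has `p ∣ ord_ℓ(Δ)`; at a SPLIT
multiplicative prime this is `p ∣ c_ℓ` and the Tamagawa clause of `RaySujathaCertAt` fails ON THE CURVE ITSELF —
whence the congruent-partner form (a partner good or non-split at `ℓ`), and the class-wide residue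
`RsPartnerSupplyNsGeFive`.
-/

set_option linter.dupNamespace false
open scoped Classical

namespace Summit.BirchSwinnertonDyer.BirchSwinnertonDyer.Cruxes.SmallImageMuZeroOneSign.RsRoad

open Literature.NumberTheory.EllipticCurves Literature.NumberTheory.EllipticCurves.Module
  Literature.NumberTheory.EllipticCurves.IwasawaAlgebra Literature.NumberTheory.EllipticCurves.IwasawaDual
  Literature.NumberTheory.EllipticCurves.Rank1Residual Literature.NumberTheory.EllipticCurves.Kobayashi2003
  WeierstrassCurve Summit.BirchSwinnertonDyer.Rank1Residual.X1.MuLambda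
  Summit.BirchSwinnertonDyer.BirchSwinnertonDyer.Theorems.SmallImageFinePivot

variable {p : ℕ} [Fact p.Prime]

/-! ## §1 Road R1 — the Ray–Sujatha certificate AT THE PAIR gives Conjecture A at the pair -/

/-- **R1.** `RaySujathaCertAt W p` (good `p`, rank ≤ 1, `p ∤ c_ℓ` for `ℓ ≠ p`, `Ш[p^∞] = 0`, `Tors D_{E,p} = 0`) ⟹
Coates–Sujatha (A) at `(W, p)`, granted Ray–Sujatha Cor. 2.7 (hRS) and Kato's torsion of `X₀` (hKato): the canonical fine
datum is finitely generated (tree theorem `FineSelmerDualData.module_finite`) and torsion (hKato), so Cor. 2.7 makes it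
FINITE, a fortiori `ℤ_p`-finite.  No reduction-type hypothesis at `p` beyond «good»: valid at supersingular `p`.
[cite: RaySujatha2021, Cor. 2.7 (arXiv:2112.13335 §2)] [cite: Kato2004Asterisque, Thm. 12.4 (1) (p. 221), (17.13.1) (p. 279)]
[cite: CoatesSujatha2005, §3 statement (A)] -/
theorem conjAAt_of_raySujathaCert
    (hRS : RaySujatha2023.cor27_fineSelmer_muInvariant_lambdaInvariant_eq_zero)
    (hKato : Kato2004_fineSelmerDual_isTorsion)
    {W : WeierstrassCurve ℚ} [W.IsElliptic] (hp : p ≠ 2) (hcert : RaySujathaCertAt W p) :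
    ConjAAt W p := by
  intro κ hκ
  obtain ⟨γ, hγ⟩ : ∃ γ : Field.absoluteGaloisGroup ℚ, κ.IsTopGenerator γ :=
    κ.surjective (Multiplicative.ofAdd 1)
  let Y : W.FineSelmerDualData κ γ := W.fineSelmerDualData κ hγ
  have hYf : Module.Finite (IwasawaAlgebra p) Y.X :=
    WeierstrassCurve.FineSelmerDualData.module_finite W κ hγ Y
  have hYt : Module.IsTorsion (IwasawaAlgebra p) Y.X := hKato W p κ γ hκ hγ Y
  obtain ⟨-, -, hfin⟩ := fineSelmerDual_finite_of_raySujathaCert hRS hp hcert κ γ hκ hγ Y hYf hYt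
  haveI : Finite (RestrictScalars ℤ_[p] (IwasawaAlgebra p) Y.X) := hfin
  exact ⟨γ, Y, Module.Finite.of_finite⟩

/-! ## §2 Road R2 — a CONGRUENT curve's certificate suffices (residual invariance of (A), proved in the tree) -/

/-- **Residual invariance of (A) in the `ConjAAt` currency** (Lim–Sujatha 2018 Prop. 3.2, the tree's sorry-free
`prop32_fineSelmerDual_moduleFinite_iff_of_torsionIso_holds`): if `E[p] ≅ E′[p]` as `Γ_ℚ`-modules and (A) holds at
`(E′, p)`, then (A) holds at `(E, p)` (`p ≠ 2`). [cite: LimSujatha2018, §3 Prop. 3.2 (arXiv:1603.08640 p. 8)] -/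
theorem conjAAt_of_congruent {W W' : WeierstrassCurve ℚ} [W.IsElliptic] [W'.IsElliptic] (hp : p ≠ 2)
    (he : ∃ e : geomTorsion W (p : ℤ) ≃+ geomTorsion W' (p : ℤ),
      ∀ (σ : Field.absoluteGaloisGroup ℚ) (P : geomTorsion W (p : ℤ)), e (σ • P) = σ • e P)
    (hA' : ConjAAt W' p) : ConjAAt W p := fun κ hκ =>
  (LimSujatha2018.prop32_fineSelmerDual_moduleFinite_iff_of_torsionIso_holds W W' p hp he κ hκ).mpr (hA' κ hκ)

/-- **R2.** A Ray–Sujatha certificate on ANY congruent curve `E′` (`E′[p] ≅ E[p]`) gives (A) at `(E, p)`.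
[cite: RaySujatha2021, Cor. 2.7] [cite: LimSujatha2018, §3 Prop. 3.2] [cite: Kato2004Asterisque, Thm. 12.4 (1)] -/
theorem conjAAt_of_congruent_raySujathaCert
    (hRS : RaySujatha2023.cor27_fineSelmer_muInvariant_lambdaInvariant_eq_zero)
    (hKato : Kato2004_fineSelmerDual_isTorsion)
    {W W' : WeierstrassCurve ℚ} [W.IsElliptic] [W'.IsElliptic] (hp : p ≠ 2)
    (he : ∃ e : geomTorsion W (p : ℤ) ≃+ geomTorsion W' (p : ℤ),
      ∀ (σ : Field.absoluteGaloisGroup ℚ) (P : geomTorsion W (p : ℤ)), e (σ • P) = σ • e P)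
    (hcert' : RaySujathaCertAt W' p) : ConjAAt W p :=
  conjAAt_of_congruent hp he (conjAAt_of_raySujathaCert hRS hKato hp hcert')

/-! ## §3 Crux M's BODY at a small-image supersingular pair from a certificate (the per-pair witness shape) -/

/-- **M at the pair from R1**: at a good supersingular pair with `a_p = 0` (the crux's local hypotheses; no image, CM or
rank hypothesis is needed by the proof — the certificate carries rank ≤ 1), a Ray–Sujatha certificate on the curve gives
ONE sign `ε` with algebraic `μ(X^ε) = 0` for all cyclotomic data — crux M's body at `(W, p)` — modulo hRS, hKato and the
fine pivot's three printed binders. [cite: RaySujatha2021, Cor. 2.7] [cite: Kobayashi2003, p. 35] [cite: PollackWeston2011, Rem. 4.2] -/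
theorem oneSignMuZero_of_raySujathaCert
    (hRS : RaySujatha2023.cor27_fineSelmer_muInvariant_lambdaInvariant_eq_zero)
    (hKato : Kato2004_fineSelmerDual_isTorsion)
    (hKP : kuriharaPollack2007_selmerDual_extension_of_fineDual)
    (hKo : signedSelmerInf_sub_fineSelmer_of_loc)
    (hMa : matar2020_thm11_selmerDualTorsion_pseudoIso_fineSelmerDual)
    (W : WeierstrassCurve ℚ) [W.IsElliptic] [W.IsGloballyMinimal] (hp : p ≠ 2)
    (hgood : W.HasGoodReductionAtPrime p) (hap : W.frobeniusTrace p = 0) (hcert : RaySujathaCertAt W p) :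
    ∃ ε : ℤˣ, ∀ (κ : ZpExtension ℚ p) (γ : Field.absoluteGaloisGroup ℚ), κ.IsCyclotomic → κ.IsTopGenerator γ →
      IsCyclotomicVariable p γ → ∀ (D : SignedSelmerDualData W κ γ ε) (ξ : IwasawaAlgebra p),
        D.charIdeal = Ideal.span {ξ} → mu ξ = 0 :=
  oneSignMuZero_of_conjAAt hKP hKo hMa W hp hgood hap (conjAAt_of_raySujathaCert hRS hKato hp hcert)

/-- **M at the pair from R2** (the shape every census row with a split multiplicative prime must use): a Ray–Sujatha
certificate on a CONGRUENT curve `W′` gives crux M's body at `(W, p)`.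
[cite: RaySujatha2021, Cor. 2.7] [cite: LimSujatha2018, §3 Prop. 3.2] [cite: Kobayashi2003, p. 35] -/
theorem oneSignMuZero_of_congruent_raySujathaCert
    (hRS : RaySujatha2023.cor27_fineSelmer_muInvariant_lambdaInvariant_eq_zero)
    (hKato : Kato2004_fineSelmerDual_isTorsion)
    (hKP : kuriharaPollack2007_selmerDual_extension_of_fineDual)
    (hKo : signedSelmerInf_sub_fineSelmer_of_loc)
    (hMa : matar2020_thm11_selmerDualTorsion_pseudoIso_fineSelmerDual)
    (W : WeierstrassCurve ℚ) [W.IsElliptic] [W.IsGloballyMinimal] (hp : p ≠ 2)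
    (hgood : W.HasGoodReductionAtPrime p) (hap : W.frobeniusTrace p = 0)
    (W' : WeierstrassCurve ℚ) [W'.IsElliptic]
    (he : ∃ e : geomTorsion W (p : ℤ) ≃+ geomTorsion W' (p : ℤ),
      ∀ (σ : Field.absoluteGaloisGroup ℚ) (P : geomTorsion W (p : ℤ)), e (σ • P) = σ • e P)
    (hcert' : RaySujathaCertAt W' p) :
    ∃ ε : ℤˣ, ∀ (κ : ZpExtension ℚ p) (γ : Field.absoluteGaloisGroup ℚ), κ.IsCyclotomic → κ.IsTopGenerator γ →
      IsCyclotomicVariable p γ → ∀ (D : SignedSelmerDualData W κ γ ε) (ξ : IwasawaAlgebra p),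
        D.charIdeal = Ideal.span {ξ} → mu ξ = 0 :=
  oneSignMuZero_of_conjAAt hKP hKo hMa W hp hgood hap
    (conjAAt_of_congruent_raySujathaCert hRS hKato hp he hcert')

/-! ## §4 The class-wide residue of the road (OPEN; a `def`, never asserted) and crux M BY NAME from it -/

/-- **`RsPartnerSupplyNsGeFive` — the OPEN class-wide input of the road** (conjecture-grade; nothing asserted): every
small-image supersingular X7 pair `(E, p)`, `p ≥ 5`, `a_p = 0`, non-CM, admits a mod-`p` congruent elliptic curve `E′/ℚ`
(possibly `E` itself) carrying a Ray–Sujatha certificate at `p`.  Per pair it is DECIDABLE from Mordell–Weil data (kit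
ASK-2 of `Lines/rs_road.md`); class-wide it is a Heegner-point-indivisibility / rank SUPPLY problem over the congruence
class `X_E(p)(ℚ)` (infinite at `p = 5`, Rubin–Silverberg; finite at `p ≥ 7`), NOT a `μ`-statement over a number field
with `p` inert — this is the transfer's change of wall.  WHY IT MIGHT FAIL: at `p ≥ 7` a congruence class may consist of
finitely many curves all of rank ≥ 2 or all with a split multiplicative prime. [cite: RaySujatha2021, Cor. 2.7]
[cite: RubinSilverberg1995, Thm. 4.1 (mod-5 families)] [cite: KrizLi2019, Thm. 1.16 (congruence of Heegner logarithms)] -/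
@[conjecture] def RsPartnerSupplyNsGeFive : Prop :=
  ∀ (W : WeierstrassCurve ℚ) [W.IsElliptic] [W.IsGloballyMinimal] (p : ℕ) [Fact p.Prime],
    5 ≤ p → ClassX7 W p → ¬ W.HasCM → W.frobeniusTrace p = 0 → ¬ Surj W p →
      ∃ (W' : WeierstrassCurve ℚ) (_ : W'.IsElliptic),
        (∃ e : geomTorsion W (p : ℤ) ≃+ geomTorsion W' (p : ℤ),
          ∀ (σ : Field.absoluteGaloisGroup ℚ) (P : geomTorsion W (p : ℤ)), e (σ • P) = σ • e P) ∧
        RaySujathaCertAt W' p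

/-- **The road discharges the LEAD's open stub shape** (`birth_mu` v3 `stub_conjA_ns_ge5`: Conjecture A on the `p ≥ 5`
small-image supersingular X7 domain) from the supply statement, modulo hRS and hKato.
[cite: CoatesSujatha2005, §3 Conjecture A] [cite: RaySujatha2021, Cor. 2.7] [cite: LimSujatha2018, Prop. 3.2] -/
theorem conjA_ns_ge5_of_rsPartnerSupply
    (hRS : RaySujatha2023.cor27_fineSelmer_muInvariant_lambdaInvariant_eq_zero)
    (hKato : Kato2004_fineSelmerDual_isTorsion) (hS : RsPartnerSupplyNsGeFive) :
    ∀ (W : WeierstrassCurve ℚ) [W.IsElliptic] [W.IsGloballyMinimal] (p : ℕ) [Fact p.Prime],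
      5 ≤ p → ClassX7 W p → ¬ W.HasCM → W.frobeniusTrace p = 0 → ¬ Surj W p → ConjAAt W p := by
  intro W _ _ p _ hp5 hX hCM hap hs
  obtain ⟨W', hW', he, hcert'⟩ := hS W p hp5 hX hCM hap hs
  have hp : p ≠ 2 := by omega
  exact conjAAt_of_congruent_raySujathaCert hRS hKato hp he hcert'

/-- **Crux M BY NAME along the road** (type literally the route decl): `p = 3` rows by the LEAD's landed `birth_mu`
print closer (binders `hCK h12 h5 h3 hmodP`), `p ≥ 5` rows by the supply statement through R2 and the fine pivot.
Displayed binders only; the supply statement is OPEN; BSD is not proved by any of this.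
[cite: Kobayashi2003, Thm. 1.2, 6.2–6.3, 7.3] [cite: RaySujatha2021, Cor. 2.7] [cite: LimSujatha2018, Prop. 3.2] -/
theorem smallImageMuZeroOneSign_of_rsPartnerSupply
    (hCK : thm62_63_73_signedColemanKato_zeta) (h12 : thm12_signedSelmerDual_finite_torsion)
    (h5 : realPeriodRat_eq_unit_mul_plusPeriod) (h3 : realPeriodRat_eq_unit_mul_plusPeriod_three)
    (hmodP : ModularForms.nonempty_modularParametrizationData)
    (hKP : kuriharaPollack2007_selmerDual_extension_of_fineDual)
    (hKo : signedSelmerInf_sub_fineSelmer_of_loc)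
    (hMa : matar2020_thm11_selmerDualTorsion_pseudoIso_fineSelmerDual)
    (hRS : RaySujatha2023.cor27_fineSelmer_muInvariant_lambdaInvariant_eq_zero)
    (hKato : Kato2004_fineSelmerDual_isTorsion) (hS : RsPartnerSupplyNsGeFive) :
    Summit.BirchSwinnertonDyer.BirchSwinnertonDyer.Theses.SignedLowerHalves.SmallImageMuZeroOneSign :=
  smallImageMuZeroOneSign_of_facts_of_conjA_ge_five hCK h12 h5 h3 hmodP hKP hKo hMa
    (conjA_ns_ge5_of_rsPartnerSupply hRS hKato hS)

/-! ## §5 (rev 2, g15) The UNIT-ZONE shortcut on the rank-0 R1 rows: B. D. Kim 2013 Cor. 3.15 instead of the fine pivot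

A RIDER, not a line: the unit zone (`#Sel^(p)(E/ℚ) = 1 ∧ p ∤ ∏c_ℓ ⟹ μ(X^±) = 0`, both signs) is the tree's
`Summit.BirchSwinnertonDyer.BirchSwinnertonDyer.Theorems.signedMu_eq_zero_of_selmerTrivial` (cell bsd-ssimc; B. D. Kim 2013
Cor. 3.15 + Kobayashi Thm. 1.2).  What §5 adds is only (i) the bridge to crux M's literal body (`μ(ξ) = 0` for a
characteristic power series, via `MuPart.mu_generator_eq_muInvariant`), (ii) the rank-0 packaging
`Ш(E/ℚ)[p] = 0 ∧ rank 0 ∧ p ∤ #E(ℚ)_tors ⟹ #Sel^(p)(E/ℚ) = 1` (contrapositive of the tree's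
`Typed.exists_sha_torsion_of_selmerGroup_ne_bot`), and (iii) the GRH-free Matar–Nekovář certificate
(`Typed.noPTorsion_of_matarNekovar_of_not_pdiv`, irreducibility from `ClassX7.irr`) in place of an explicit `p`-descent —
so that the twelve R1 rows of `Lines/rs_road.md` §4 (nine at `p = 5`, three at `p = 11`) carry crux M's body with the two
print binders `h12`, `hKim` (+ the per-pair Heegner data) and no fine-Selmer fact at all. -/

/-- **Both signs from a trivial `p`-Selmer group** (the unit zone, bridged to `μ(ξ) = 0`): `p` odd good with `a_p = 0`,
`#Sel^(p)(E/ℚ) = 1`, `p ∤ ∏c_ℓ` ⟹ for EVERY sign, every cyclotomic datum and every characteristic power series `ξ` of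
`X^ε`, `μ(ξ) = 0`.  Print binders: Kobayashi Thm. 1.2 (`h12`), B. D. Kim 2013 Cor. 3.15 (`hKim`).
[cite: BDKim2013, Cor. 3.15 (p. 199)] [cite: Kobayashi2003, Thm. 1.2 (p. 2)] [cite: Washington1997, §13.2] -/
theorem signedMu_bothSigns_of_selmerTrivial
    (h12 : thm12_signedSelmerDual_finite_torsion) (hKim : BDKim2013.cor315_signedCharValue_rankZero)
    (W : WeierstrassCurve ℚ) [W.IsElliptic] [W.IsGloballyMinimal] (hp : p ≠ 2)
    (hgood : W.HasGoodReductionAtPrime p) (hap : W.frobeniusTrace p = 0)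
    (hSel : Nat.card (W.selmerGroup (p : ℤ)) = 1) (htam : ¬ p ∣ W.tamagawaProduct)
    (ε : ℤˣ) {κ : ZpExtension ℚ p} {γ : Field.absoluteGaloisGroup ℚ} (hκ : κ.IsCyclotomic)
    (hγ : κ.IsTopGenerator γ) (D : SignedSelmerDualData W κ γ ε) (ξ : IwasawaAlgebra p)
    (hξ : D.charIdeal = Ideal.span {ξ}) : mu ξ = 0 := by
  have hμ : D.mu = 0 :=
    Summit.BirchSwinnertonDyer.BirchSwinnertonDyer.Theorems.signedMu_eq_zero_of_selmerTrivial
      W p h12 hKim hp hgood hap hSel htam hκ hγ ε D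
  haveI : Module.Finite (IwasawaAlgebra p) D.X := h12.moduleFinite hp hgood hap hκ hγ D
  have hX : Module.IsTorsion (IwasawaAlgebra p) D.X := h12.isTorsion hp hgood hap hκ hγ D
  have hξ' : Literature.NumberTheory.EllipticCurves.Module.charIdeal (IwasawaAlgebra p) D.X = Ideal.span {ξ} := hξ
  have h0 : ξ ≠ 0 := by
    rintro rfl
    exact Literature.NumberTheory.EllipticCurves.Module.charIdeal_ne_bot (IwasawaAlgebra p) D.X
      (hξ'.trans (Ideal.span_singleton_eq_bot.mpr rfl))
  have hgen := Summit.BirchSwinnertonDyer.Rank1Residual.X1.MuPart.mu_generator_eq_muInvariant D.X hX h0 hξ'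
  rw [hgen]
  exact hμ

/-- **Crux M's body at the pair from the unit zone** (ONE sign suffices; here every sign works): the shape of
`oneSignMuZero_of_raySujathaCert` with the certificate `#Sel^(p)(E/ℚ) = 1 ∧ p ∤ ∏c_ℓ` and the two print binders
`h12`, `hKim` only — no fine-Selmer fact, no `hKP hKo hMa`. [cite: BDKim2013, Cor. 3.15 (p. 199)] [cite: Kobayashi2003, Thm. 1.2 (p. 2)] -/
theorem oneSignMuZero_of_selmerTrivial
    (h12 : thm12_signedSelmerDual_finite_torsion) (hKim : BDKim2013.cor315_signedCharValue_rankZero)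
    (W : WeierstrassCurve ℚ) [W.IsElliptic] [W.IsGloballyMinimal] (hp : p ≠ 2)
    (hgood : W.HasGoodReductionAtPrime p) (hap : W.frobeniusTrace p = 0)
    (hSel : Nat.card (W.selmerGroup (p : ℤ)) = 1) (htam : ¬ p ∣ W.tamagawaProduct) :
    ∃ ε : ℤˣ, ∀ (κ : ZpExtension ℚ p) (γ : Field.absoluteGaloisGroup ℚ), κ.IsCyclotomic → κ.IsTopGenerator γ →
      IsCyclotomicVariable p γ → ∀ (D : SignedSelmerDualData W κ γ ε) (ξ : IwasawaAlgebra p),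
        D.charIdeal = Ideal.span {ξ} → mu ξ = 0 :=
  ⟨1, fun _ _ hκ hγ _ D ξ hξ ↦ signedMu_bothSigns_of_selmerTrivial h12 hKim W hp hgood hap hSel htam 1 hκ hγ D ξ hξ⟩

/-- **The rank-0 packaging of the certificate**: `rank E(ℚ) = 0`, `p ∤ #E(ℚ)_tors` and `Ш(E/ℚ)[p] = 0` ⟹
`#Sel^(p)(E/ℚ) = 1` (the descent sequence `0 → E(ℚ)/p → Sel^(p) → Ш[p] → 0`; contrapositive of the tree's
`Typed.exists_sha_torsion_of_selmerGroup_ne_bot`). [cite: SilvermanAEC2009, Thm X.4.2] -/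
theorem natCard_selmerGroup_eq_one_of_noPTorsion (W : WeierstrassCurve ℚ) [W.IsElliptic]
    (hrank : W.mordellWeilRank = 0) (htors : ¬ p ∣ W.torsionOrder)
    (hSha : ∀ x : W.sha, (p : ℤ) • x = 0 → x = 0) : Nat.card (W.selmerGroup (p : ℤ)) = 1 := by
  have hbot : W.selmerGroup (p : ℤ) = ⊥ := by
    by_contra hne
    obtain ⟨x, hx0, hpx⟩ :=
      Literature.NumberTheory.EllipticCurves.Rank1Residual.Typed.exists_sha_torsion_of_selmerGroup_ne_bot
        W p hne hrank htors
    exact hx0 (hSha x (by rw [natCast_zsmul]; exact hpx))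
  rw [hbot]
  exact AddSubgroup.card_bot

/-- **Crux M's body at a rank-0 X7 pair from a Heegner-index certificate — GRH-free, no descent, no fine-Selmer fact.**
`p` odd, `(E, p)` an X7 pair with `a_p = 0` (so `E[p]` irreducible, `ClassX7.irr`), `rank E(ℚ) = 0`, `p ∤ #E(ℚ)_tors`,
`p ∤ ∏c_ℓ`; Heegner data: `K` imaginary quadratic with the Heegner hypothesis for `N`, a Heegner point `y_K = P ∈ E(K)`
with `y_K ∉ pE(K)` (`hdiv`, decided by reduction modulo a few good primes), `(K, p) ≠ (ℚ(√−3), 3)`.  Granted BY NAME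
Matar–Nekovář 2019 Thm. 6.7 (1) (`hMN`), Kobayashi Thm. 1.2 (`h12`) and B. D. Kim 2013 Cor. 3.15 (`hKim`): ONE sign
(indeed both) with `μ(ξ) = 0` for every cyclotomic datum — crux M's body at `(W, p)`.  This is the instrument for the
twelve R1 rows of `Lines/rs_road.md` §4 at `p ∈ {5, 11}`; per pair, CONDITIONAL on the displayed binders; closes nothing
class-wide; BSD is not proved by any of this.
[cite: MatarNekovar2019, Thm. 6.7 (1) (p. 498)] [cite: BDKim2013, Cor. 3.15 (p. 199)] [cite: Kobayashi2003, Thm. 1.2 (p. 2)]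
[cite: Serre1972, §1.11 Prop. 12] -/
theorem oneSignMuZero_of_matarNekovar_unitZone
    (h12 : thm12_signedSelmerDual_finite_torsion) (hKim : BDKim2013.cor315_signedCharValue_rankZero)
    (W : WeierstrassCurve ℚ) [W.IsElliptic] [W.IsGloballyMinimal] (hp : p ≠ 2) (hX : ClassX7 W p)
    (hap : W.frobeniusTrace p = 0) {N : ℕ} [NeZero N] {K : Type} [Field K] [NumberField K]
    (hMN : MatarNekovar2019.thm67_sha_primary_trivial_of_irreducible N W K)
    (hK : IsImaginaryQuadratic K) (hH : SatisfiesHeegnerHypothesis N K)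
    {P : (W.baseChange K).toAffine.Point} (hP : IsHeegnerPoint N W K P)
    (h3 : p = 3 → NumberField.discr K ≠ -3) (hdiv : ¬ ∃ Q : (W.baseChange K).toAffine.Point, p • Q = P)
    (hrank : W.mordellWeilRank = 0) (htors : ¬ p ∣ W.torsionOrder) (htam : ¬ p ∣ W.tamagawaProduct) :
    ∃ ε : ℤˣ, ∀ (κ : ZpExtension ℚ p) (γ : Field.absoluteGaloisGroup ℚ), κ.IsCyclotomic → κ.IsTopGenerator γ →
      IsCyclotomicVariable p γ → ∀ (D : SignedSelmerDualData W κ γ ε) (ξ : IwasawaAlgebra p),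
        D.charIdeal = Ideal.span {ξ} → mu ξ = 0 :=
  oneSignMuZero_of_selmerTrivial h12 hKim W hp hX.1.1 hap
    (natCard_selmerGroup_eq_one_of_noPTorsion W hrank htors
      (Literature.NumberTheory.EllipticCurves.Rank1Residual.Typed.noPTorsion_of_matarNekovar_of_not_pdiv
        W p hMN hK hH hP hp (ClassX7.irr W p hp hX) h3 hdiv))
    htam

/-- **The unit-PARTNER form (R2's analogue on the signed side)**: a mod-`p` congruent curve `A` good at `p` with
`a_p(A) = 0`, `#Sel^(p)(A/ℚ) = 1`, `p ∤ ∏c_ℓ(A)` gives crux M's body at `(W, p)` for EVERY sign through B. D. Kim 2009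
Cor. 2.13 (`h09`, tree `…Theorems.mu_eq_zero_of_unitPartner`) — the congruence moves `μ(X^±) = 0` itself, not
Conjecture A (contrast `oneSignMuZero_of_congruent_raySujathaCert`: partner of rank ≤ 1, any potentially good
reduction at `p`, via Lim–Sujatha; here: partner of `p`-Selmer rank 0, good supersingular at `p`, three print binders).
[cite: BDKim2009, Cor. 2.13 (p. 187)] [cite: BDKim2013, Cor. 3.15 (p. 199)] [cite: Kobayashi2003, Thm. 1.2 (p. 2)] -/
theorem oneSignMuZero_of_unitPartner
    (h09 : BDKim2009.cor213_signedMu_eq_zero_iff_of_torsionIso)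
    (h12 : thm12_signedSelmerDual_finite_torsion) (hKim : BDKim2013.cor315_signedCharValue_rankZero)
    (W : WeierstrassCurve ℚ) [W.IsElliptic] [W.IsGloballyMinimal] (hp : p ≠ 2)
    (hgood : W.HasGoodReductionAtPrime p) (hap : W.frobeniusTrace p = 0)
    (A : WeierstrassCurve ℚ) [A.IsElliptic] [A.IsGloballyMinimal]
    (hgoodA : A.HasGoodReductionAtPrime p) (hapA : A.frobeniusTrace p = 0)
    (hiso : ∃ e : geomTorsion W (p : ℤ) ≃+ geomTorsion A (p : ℤ),
      ∀ (σ : Field.absoluteGaloisGroup ℚ) (P : geomTorsion W (p : ℤ)), e (σ • P) = σ • e P)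
    (hSelA : Nat.card (A.selmerGroup (p : ℤ)) = 1) (htamA : ¬ p ∣ A.tamagawaProduct) :
    ∃ ε : ℤˣ, ∀ (κ : ZpExtension ℚ p) (γ : Field.absoluteGaloisGroup ℚ), κ.IsCyclotomic → κ.IsTopGenerator γ →
      IsCyclotomicVariable p γ → ∀ (D : SignedSelmerDualData W κ γ ε) (ξ : IwasawaAlgebra p),
        D.charIdeal = Ideal.span {ξ} → mu ξ = 0 := by
  refine ⟨1, fun κ γ hκ hγ _ D ξ hξ ↦ ?_⟩
  have hμ : D.mu = 0 :=
    Summit.BirchSwinnertonDyer.BirchSwinnertonDyer.Theorems.mu_eq_zero_of_unitPartner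
      W A p h09 h12 hKim hp hgood hap hgoodA hapA hiso hSelA htamA hκ hγ 1 D
  haveI : Module.Finite (IwasawaAlgebra p) D.X := h12.moduleFinite hp hgood hap hκ hγ D
  have hX : Module.IsTorsion (IwasawaAlgebra p) D.X := h12.isTorsion hp hgood hap hκ hγ D
  have hξ' : Literature.NumberTheory.EllipticCurves.Module.charIdeal (IwasawaAlgebra p) D.X = Ideal.span {ξ} := hξ
  have h0 : ξ ≠ 0 := by
    rintro rfl
    exact Literature.NumberTheory.EllipticCurves.Module.charIdeal_ne_bot (IwasawaAlgebra p) D.X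
      (hξ'.trans (Ideal.span_singleton_eq_bot.mpr rfl))
  have hgen := Summit.BirchSwinnertonDyer.Rank1Residual.X1.MuPart.mu_generator_eq_muInvariant D.X hX h0 hξ'
  rw [hgen]
  exact hμ

end Summit.BirchSwinnertonDyer.BirchSwinnertonDyer.Cruxes.SmallImageMuZeroOneSign.RsRoad
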